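import Summits.ResolutionOfSingularities.ResolutionOfSingularities.Theorems.ValuativeLuAlphaPTorsorAdaptedDefs
import Summits.ResolutionOfSingularities.ResolutionOfSingularities.Theorems.ValuativeLuAlphaPTorsorValueStep
import Summits.ResolutionOfSingularities.ResolutionOfSingularities.Theorems.ValuativeLuAlphaPTorsorPerronMonomialization
import Mathlib.RingTheory.Valuation.ValuationSubring
import Mathlib.RingTheory.Adjoin.FG
import Mathlib.Algebra.Field.Subfield.Basic
import HarnessLib

/-!
# Adapted value step, IV: the re-based chart `R₁ = R[y]`

Crux `Valuative.LuAlphaPTorsor` (stmt-ResolutionOfSingularities-0641), line `pfaff-line-log-final-forms`,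
registered stub `stub_adaptedValueStep` (F6v, wave 2: the ADAPTED value step of the purely
inseparable tower, any rank) — helper file 4/8.

`adValue_construct`: in the setting of the value step (`t ^ p = x^α · u`, `v(u) = 1`, `u` a unit
of `R`, `v(t) ∉ ⊕ ℤ v(xᵢ)`, `(R, x)` very good), the toric re-basing of S4
(`valueStep_lattice_rebase`) followed by the flag-adapted unimodular re-parametrization F¹
(hypothesis) gives Laurent monomials `y₁, …, yₙ` in `x, t` with flag-adapted `ℤ`-independent
values `< 1`, every `xᵢ` and `t` an `ℕ`-monomial in `y` times a unit of `R`, and the very good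
chart `R₁ = R[y] ∋ t` inside `O` and `Frac (R[t])` (centre by S3's `perron_span_eq_centre`,
independence by `perron_valIndep_of_matrix`). Plus small lemmas on Laurent monomials in `x, t`.
[folklore]
-/

noncomputable section

-- `Summit.<S>.<S>.…` duplicates the summit name by design (D-0017, single-problem summit).
set_option linter.dupNamespace false

open IsLocalRing

namespace Summit.ResolutionOfSingularities.ResolutionOfSingularities.Theorems.PfaffLine

open Literature.AlgebraicGeometry.Resolution

/-- **The flag-adapted re-basing of the value step.** In the setting of the value step
(`t ^ p = x^α · u`, `v(u) = 1`, `u` a unit of `R`, `v(t) ∉ ⊕ ℤ v(xᵢ)`, `(R, x)` a very good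
chart), the toric re-basing of S4 (`valueStep_lattice_rebase`) followed by the flag-adapted
unimodular re-parametrization F¹ (hypothesis `hF1`) produces Laurent monomials `y₁, …, yₙ` in
`x, t` with values `< 1`, `ℤ`-independent and FLAG-ADAPTED for some level map `lv'`, such that
every `xᵢ` and `t` is an `ℕ`-monomial in `y` times a unit of `R`, and `R₁ := R[y]` is a very
good chart containing `t`, finitely generated, inside `O` and inside `Frac (R[t])`. -/
theorem adValue_construct {p : ℕ} (hp : p.Prime)
    (hF1 : ∀ (Γ₀ : Type) [LinearOrderedCommGroupWithZero Γ₀] (n : ℕ) (τ : Fin n → Γ₀), (∀ i, τ i ≠ 0) → (∀ m : Fin n → ℤ, (∏ i, τ i ^ (m i)) = 1 → m = 0) → ∀ (H : Finset (Fin n → ℤ)), (∀ h ∈ H, (∏ i, τ i ^ (h i)) ≤ 1) → ∃ (C D : Matrix (Fin n) (Fin n) ℤ), C * D = 1 ∧ D * C = 1 ∧ (∀ j, (∏ i, τ i ^ (C j i)) < 1) ∧ (∀ h ∈ H, ∃ e : Fin n → ℕ, ∀ i, h i = ∑ j, (e j : ℤ) * C j i) ∧ ∃ lv : Fin n → ℕ,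 FlagAdaptedValues (fun j => ∏ i, τ i ^ (C j i)) lv)
    {k K : Type} [Field k] [Field K] [Algebra k K] (O : ValuationSubring K) {n : ℕ}
    (R : Subalgebra k K) (hRO : R.toSubring ≤ O.toSubring) (x : Fin n → K) (hx : ∀ i, x i ∈ R)
    (hRfg : R.FG) (hx0 : ∀ i, x i ≠ 0)
    (hcen : Ideal.span (Set.range fun i => (⟨x i, hx i⟩ : R.toSubring)) =
      Ideal.comap (Subring.inclusion hRO) (maximalIdeal O))
    (hind : ∀ m : Fin n → ℤ, (∏ i, O.valuation (x i) ^ (m i)) = 1 → m = 0)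
    (t u : K) (α : Fin n → ℕ) (huR : u ∈ R) (huiR : u⁻¹ ∈ R) (hvu : O.valuation u = 1)
    (htp : t ^ p = (∏ i, x i ^ (α i)) * u)
    (hvt : ∀ m : Fin n → ℤ, O.valuation t ≠ ∏ i, O.valuation (x i) ^ (m i)) :
    ∃ (y : Fin n → K) (lv' : Fin n → ℕ) (c : Fin n → Fin n → ℕ) (w : Fin n → K) (f : Fin n → ℕ)
      (wt : K) (hR₁O : (Algebra.adjoin k ((R : Set K) ∪ Set.range y)).toSubring ≤ O.toSubring)
      (hy : ∀ j, y j ∈ Algebra.adjoin k ((R : Set K) ∪ Set.range y)),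
      (∀ j, ∃ (a : Fin n → ℤ) (b : ℤ), y j = (∏ i, x i ^ (a i)) * t ^ b) ∧
      (∀ j, y j ≠ 0) ∧ (∀ j, O.valuation (y j) < 1) ∧
      (∀ m : Fin n → ℤ, (∏ j, O.valuation (y j) ^ (m j)) = 1 → m = 0) ∧
      FlagAdaptedValues (fun j => O.valuation (y j)) lv' ∧
      (∀ i, w i ∈ R ∧ (w i)⁻¹ ∈ R ∧ x i = (∏ j, y j ^ (c i j)) * w i) ∧
      (wt ∈ R ∧ t = (∏ j, y j ^ (f j)) * wt) ∧
      R ≤ Algebra.adjoin k ((R : Set K) ∪ Set.range y) ∧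
      t ∈ Algebra.adjoin k ((R : Set K) ∪ Set.range y) ∧
      (Algebra.adjoin k ((R : Set K) ∪ Set.range y)).FG ∧
      ((Algebra.adjoin k ((R : Set K) ∪ Set.range y) : Set K) ⊆
        Subfield.closure ((R : Set K) ∪ {t})) ∧
      Ideal.span (Set.range fun j =>
          (⟨y j, hy j⟩ : (Algebra.adjoin k ((R : Set K) ∪ Set.range y)).toSubring)) =
        Ideal.comap (Subring.inclusion hR₁O) (maximalIdeal O) := by
  classical
  -- ### non-vanishing and values (as in S4)
  have hp0 : p ≠ 0 := hp.ne_zero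
  have hu0 : u ≠ 0 := fun h => zero_ne_one (by rw [← hvu, h, map_zero])
  have ht0 : t ≠ 0 := by
    rintro rfl
    rw [zero_pow hp0, zero_eq_mul] at htp
    rcases htp with h | h
    · exact Finset.prod_ne_zero_iff.mpr (fun i _ => pow_ne_zero _ (hx0 i)) h
    · exact hu0 h
  have hvx0 : ∀ i, O.valuation (x i) ≠ 0 := fun i => (Valuation.ne_zero_iff _).mpr (hx0 i)
  have hvt0 : O.valuation t ≠ 0 := (Valuation.ne_zero_iff _).mpr ht0
  have hvx1 : ∀ i, O.valuation (x i) < 1 := fun i =>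
    (valueStep_mem_centre_iff O hRO ⟨x i, hx i⟩).mp (by
      rw [← hcen]
      exact Ideal.subset_span ⟨i, rfl⟩)
  have hvtp : O.valuation t ^ p = ∏ i, O.valuation (x i) ^ (α i) := by
    rw [← map_pow, htp, map_mul, hvu, mul_one, map_prod]
    exact Finset.prod_congr rfl fun i _ => map_pow _ _ _
  have hvt1 : O.valuation t ≤ 1 := by
    rw [← pow_le_one_iff hp0, hvtp]
    exact Finset.prod_le_one' fun i _ => pow_le_one' (hvx1 i).le _
  have hvmono : ∀ c : Fin n → ℤ,
      O.valuation (∏ i, x i ^ (c i)) = ∏ i, O.valuation (x i) ^ (c i) := fun c => by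
    rw [map_prod]
    exact Finset.prod_congr rfl fun i _ => map_zpow₀ _ _ _
  -- ### the re-based value lattice (S4)
  obtain ⟨ε, A, B, C, D, hε0, hε1, hεAB, hτC, hθD, hεind⟩ :=
    valueStep_lattice_rebase hp0 (fun i => O.valuation (x i)) hvx0 (fun i => (hvx1 i).le) hind
      (O.valuation t) hvt0 hvt1 α hvtp
  -- ### the first coordinates `y₀`
  let y₀ : Fin n → K := fun j => (∏ i, x i ^ (A j i)) * t ^ (B j)
  have hvy₀ : ∀ j, O.valuation (y₀ j) = ε j := fun j => by
    rw [hεAB j, ← hvmono, ← map_zpow₀, ← map_mul]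
  have hy₀0 : ∀ j, y₀ j ≠ 0 := fun j h => hε0 j (by rw [← hvy₀, h, map_zero])
  have hind₀ : ∀ m : Fin n → ℤ, (∏ j, O.valuation (y₀ j) ^ (m j)) = 1 → m = 0 := fun m hm =>
    hεind m (by rw [← hm]; exact Finset.prod_congr rfl fun j _ => by rw [hvy₀])
  -- ### the flag-adapted re-parametrization F¹
  let H : Finset (Fin n → ℤ) :=
    (Finset.univ.image fun i => fun j => (C i j : ℤ)) ∪ {fun j => (D j : ℤ)}
  have hH : ∀ h ∈ H, (∏ j, ε j ^ (h j)) ≤ 1 := by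
    intro h hh
    simp only [H, Finset.mem_union, Finset.mem_image, Finset.mem_univ, true_and,
      Finset.mem_singleton] at hh
    rcases hh with ⟨i, rfl⟩ | rfl
    · simp only [zpow_natCast, ← hτC i]
      exact (hvx1 i).le
    · simp only [zpow_natCast, ← hθD]
      exact hvt1
  obtain ⟨C', D', hCD, -, hpos, hexp, lv', hFAV⟩ := hF1 O.ValueGroup n ε hε0 hεind H hH
  -- ### the new coordinates `y`
  let y : Fin n → K := fun j => ∏ i, y₀ i ^ (C' j i)
  have hyj : ∀ j, y j = ∏ i, y₀ i ^ (C' j i) := fun j => rfl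
  have hvy : ∀ j, O.valuation (y j) = ∏ i, ε i ^ (C' j i) := fun j => by
    rw [hyj, valuation_prod_zpow y₀ O]
    exact Finset.prod_congr rfl fun i _ => by rw [hvy₀]
  have hvy1 : ∀ j, O.valuation (y j) < 1 := fun j => by rw [hvy]; exact hpos j
  have hy0 : ∀ j, y j ≠ 0 := fun j => prod_zpow_ne_zero y₀ hy₀0 _
  have hyO : ∀ j, y j ∈ O := fun j => (O.valuation_le_one_iff _).mp (hvy1 j).le
  have hyind := perron_valIndep_of_matrix O y₀ hy₀0 hind₀ C' D' hCD y hyj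
  have hFAVy : FlagAdaptedValues (fun j => O.valuation (y j)) lv' := by
    have : (fun j => O.valuation (y j)) = fun j => ∏ i, ε i ^ (C' j i) := funext hvy
    rw [this]
    exact hFAV
  -- ### Laurent monomials in `x, t` (as in S4)
  let IsMono : K → Prop := fun z => ∃ (a : Fin n → ℤ) (b : ℤ), z = (∏ i, x i ^ (a i)) * t ^ b
  have mono_mul : ∀ z w, IsMono z → IsMono w → IsMono (z * w) := by
    rintro z w ⟨a, b, rfl⟩ ⟨a', b', rfl⟩
    refine ⟨a + a', b + b', ?_⟩
    rw [prod_zpow_add_eq x hx0, zpow_add₀ ht0]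
    ring
  have mono_inv : ∀ z, IsMono z → IsMono z⁻¹ := by
    rintro z ⟨a, b, rfl⟩
    refine ⟨-a, -b, ?_⟩
    rw [prod_zpow_neg_eq, zpow_neg, mul_inv]
  have mono_one : IsMono 1 := ⟨0, 0, by simp⟩
  have mono_prod : ∀ g : Fin n → K, (∀ j, IsMono (g j)) → IsMono (∏ j, g j) := fun g hg =>
    Finset.prod_induction g IsMono (fun a b ha hb => mono_mul a b ha hb) mono_one fun j _ => hg j
  have mono_pow : ∀ (z : K) (m : ℕ), IsMono z → IsMono (z ^ m) := fun z m hz => by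
    induction m with
    | zero => simpa using mono_one
    | succ m ih =>
      rw [pow_succ]
      exact mono_mul _ _ ih hz
  have mono_zpow : ∀ (z : K) (m : ℤ), IsMono z → IsMono (z ^ m) := fun z m hz => by
    cases m with
    | ofNat m => rw [Int.ofNat_eq_natCast, zpow_natCast]; exact mono_pow z m hz
    | negSucc m => rw [zpow_negSucc]; exact mono_inv _ (mono_pow z _ hz)
  have mono_x : ∀ i, IsMono (x i) := fun i => ⟨Pi.single i 1, 0, by
    rw [zpow_zero, mul_one, Finset.prod_eq_single i (fun j _ hj => by
      rw [Pi.single_eq_of_ne hj, zpow_zero]) (fun h => absurd (Finset.mem_univ i) h),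
      Pi.single_eq_same, zpow_one]⟩
  have mono_t : IsMono t := ⟨0, 1, by simp⟩
  have mono_y₀ : ∀ j, IsMono (y₀ j) := fun j => ⟨A j, B j, rfl⟩
  have mono_y : ∀ j, IsMono (y j) := fun j => mono_prod _ fun i => mono_zpow _ _ (mono_y₀ i)
  have hxF : ∀ i, x i ∈ Subfield.closure ((R : Set K) ∪ {t}) := fun i =>
    Subfield.subset_closure (Or.inl (hx i))
  have htF : t ∈ Subfield.closure ((R : Set K) ∪ {t}) :=
    Subfield.subset_closure (Or.inr rfl)
  have mono_mem_closure : ∀ z, IsMono z → z ∈ Subfield.closure ((R : Set K) ∪ {t}) := by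
    rintro z ⟨a, b, rfl⟩
    exact mul_mem (prod_mem fun i _ => zpow_mem (hxF i) _) (zpow_mem htF _)
  have mono_unit : ∀ z, IsMono z → O.valuation z = 1 → z ∈ R ∧ z⁻¹ ∈ R := by
    rintro z ⟨a, b, rfl⟩ h1
    obtain ⟨q, hq⟩ := valueStep_mono_eq_zpow O hp x hx0 hind t u ht0 α hvu htp hvt a b h1
    rw [hq, ← zpow_neg]
    exact ⟨valueStep_zpow_mem R huR huiR q, valueStep_zpow_mem R huR huiR (-q)⟩
  -- ### `x i` and `t` are monomials in `y` up to units of `R`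
  have hdecomp : ∀ (z : K) (e : Fin n → ℕ), IsMono z →
      O.valuation z = O.valuation (∏ j, y j ^ (e j)) →
      ∃ w, w ∈ R ∧ w⁻¹ ∈ R ∧ z = (∏ j, y j ^ (e j)) * w := by
    intro z e hz hvz
    have hP0 : (∏ j, y j ^ (e j)) ≠ 0 :=
      Finset.prod_ne_zero_iff.mpr fun j _ => pow_ne_zero _ (hy0 j)
    obtain ⟨h1, h2⟩ := mono_unit _
      (mono_mul _ _ hz (mono_inv _ (mono_prod _ fun j => mono_pow _ _ (mono_y j)))) (by
        rw [map_mul, map_inv₀, hvz]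
        exact mul_inv_cancel₀ ((map_ne_zero _).mpr hP0))
    refine ⟨z * (∏ j, y j ^ (e j))⁻¹, h1, h2, ?_⟩
    rw [mul_left_comm, mul_inv_cancel₀ hP0, mul_one]
  have hHC : ∀ i, (fun j => (C i j : ℤ)) ∈ H := fun i =>
    Finset.mem_union_left _ (Finset.mem_image_of_mem _ (Finset.mem_univ i))
  have hHD : (fun j => (D j : ℤ)) ∈ H := Finset.mem_union_right _ (Finset.mem_singleton_self _)
  have hexp' : ∀ h ∈ H, ∃ e : Fin n → ℕ, (∏ j, y₀ j ^ (h j)) = ∏ l, y l ^ (e l) := by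
    intro h hh
    obtain ⟨e, he⟩ := hexp h hh
    exact ⟨e, perron_prod_zpow_eq_prod_pow y₀ hy₀0 C' y hyj h e he⟩
  have hxdec : ∀ i, ∃ (e : Fin n → ℕ) (w : K), w ∈ R ∧ w⁻¹ ∈ R ∧
      x i = (∏ j, y j ^ (e j)) * w := by
    intro i
    obtain ⟨e, he⟩ := hexp' _ (hHC i)
    obtain ⟨w, hw, hwi, hxw⟩ := hdecomp (x i) e (mono_x i) (by
      rw [← he, valuation_prod_zpow y₀ O]
      simp only [zpow_natCast, hvy₀]
      exact hτC i)
    exact ⟨e, w, hw, hwi, hxw⟩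
  choose c w hw hwi hxw using hxdec
  have hw0 : ∀ i, w i ≠ 0 := fun i h => hx0 i (by rw [hxw i, h, mul_zero])
  have hvw : ∀ i, O.valuation (w i) = 1 := fun i => by
    refine le_antisymm ((O.valuation_le_one_iff _).mpr (hRO (hw i))) ?_
    have h2 := (O.valuation_le_one_iff _).mpr (hRO (hwi i))
    rw [map_inv₀, inv_le_one₀ ((Valuation.pos_iff _).mpr (hw0 i))] at h2
    exact h2
  obtain ⟨f, hf⟩ := hexp' _ hHD
  obtain ⟨wt, hwtR, -, htwt⟩ := hdecomp t f mono_t (by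
    rw [← hf, valuation_prod_zpow y₀ O]
    simp only [zpow_natCast, hvy₀]
    exact hθD)
  -- ### the new chart `R₁ = R[y]`
  let R₁ : Subalgebra k K := Algebra.adjoin k ((R : Set K) ∪ Set.range y)
  have hRR₁ : R ≤ R₁ := fun z hz => Algebra.subset_adjoin (Or.inl hz)
  have hyR₁ : ∀ j, y j ∈ R₁ := fun j => Algebra.subset_adjoin (Or.inr ⟨j, rfl⟩)
  have hR₁le : ∀ S : Subring K, R.toSubring ≤ S → (∀ j, y j ∈ S) → R₁.toSubring ≤ S := by
    intro S h1 h2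
    let Salg : Subalgebra k K := { S with algebraMap_mem' := fun c => h1 (R.algebraMap_mem c) }
    change R₁ ≤ Salg
    refine Algebra.adjoin_le ?_
    rintro z (hz | ⟨j, rfl⟩)
    exacts [h1 hz, h2 j]
  have hR₁O : R₁.toSubring ≤ O.toSubring := hR₁le O.toSubring hRO fun j => hyO j
  have htR₁ : t ∈ R₁ := by
    rw [htwt]
    exact mul_mem (prod_mem fun j _ => pow_mem (hyR₁ j) _) (hRR₁ hwtR)
  have hR₁fg : R₁.FG := by
    obtain ⟨S₀, hS₀⟩ := hRfg
    refine Subalgebra.fg_def.mpr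
      ⟨↑S₀ ∪ Set.range y, S₀.finite_toSet.union (Set.finite_range y), ?_⟩
    change Algebra.adjoin k (↑S₀ ∪ Set.range y) = Algebra.adjoin k (↑R ∪ Set.range y)
    rw [Algebra.adjoin_union, Algebra.adjoin_union, hS₀, Algebra.adjoin_eq]
  have hR₁F : (R₁ : Set K) ⊆ Subfield.closure ((R : Set K) ∪ {t}) := fun z hz =>
    hR₁le (Subfield.closure ((R : Set K) ∪ {t})).toSubring
      (fun w hw => Subfield.subset_closure (Or.inl hw)) (fun j => mono_mem_closure _ (mono_y j)) hz
  -- the centre of `R₁`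
  have hxJ : ∀ i, (⟨x i, hRR₁ (hx i)⟩ : R₁.toSubring) ∈
      Ideal.span (Set.range fun j => (⟨y j, hyR₁ j⟩ : R₁.toSubring)) := by
    intro i
    have hc0 : c i ≠ 0 := by
      intro h0
      refine (hvx1 i).ne ?_
      rw [hxw i, h0, map_mul, hvw i, mul_one]
      simp only [Pi.zero_apply, pow_zero, Finset.prod_const_one, map_one]
    obtain ⟨j, hj⟩ := Function.ne_iff.mp hc0
    have heq : (⟨x i, hRR₁ (hx i)⟩ : R₁.toSubring) =
        (∏ j, (⟨y j, hyR₁ j⟩ : R₁.toSubring) ^ (c i j)) * ⟨w i, hRR₁ (hw i)⟩ :=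
      Subtype.ext (by push_cast; exact hxw i)
    rw [heq]
    exact Ideal.mul_mem_right _ _ (perron_prod_pow_mem_span _ (c i) hj)
  have hcen₁ := perron_span_eq_centre O R hRO x hx hcen y R₁ rfl hR₁O hRR₁ hyR₁ hvy1 hxJ
  exact ⟨y, lv', c, w, f, wt, hR₁O, hyR₁, mono_y, hy0, hvy1, hyind, hFAVy,
    fun i => ⟨hw i, hwi i, hxw i⟩, ⟨hwtR, htwt⟩, hRR₁, htR₁, hR₁fg, hR₁F, hcen₁⟩


section Theta

variable {k K : Type} [Field k] [Field K] [Algebra k K] (O : ValuationSubring K) {n : ℕ}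

/-- Euclidean division of an integer exponent by `p`. -/
theorem adValue_ediv (p : ℕ) (hp : p ≠ 0) (b : ℤ) : ∃ (q : ℤ) (s : ℕ), s < p ∧ b = p * q + s := by
  have hp0 : (p : ℤ) ≠ 0 := by exact_mod_cast hp
  refine ⟨b / p, (b % p).toNat, ?_, ?_⟩
  · have h2 := Int.emod_lt_of_pos b (by exact_mod_cast Nat.pos_of_ne_zero hp : (0 : ℤ) < p)
    have h3 := Int.emod_nonneg b hp0
    omega
  · rw [Int.toNat_of_nonneg (Int.emod_nonneg b hp0)]
    exact (Int.mul_ediv_add_emod b p).symm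

/-- In the value step `t ≠ 0`. -/
theorem adValue_t_ne_zero {p : ℕ} (hp0 : p ≠ 0) (x : Fin n → K) (hx0 : ∀ i, x i ≠ 0) (t u : K)
    (α : Fin n → ℕ) (hvu : O.valuation u = 1) (htp : t ^ p = (∏ i, x i ^ (α i)) * u) : t ≠ 0 := by
  rintro rfl
  rw [zero_pow hp0, zero_eq_mul] at htp
  rcases htp with h | h
  · exact Finset.prod_ne_zero_iff.mpr (fun i _ => pow_ne_zero _ (hx0 i)) h
  · exact zero_ne_one (by rw [← hvu, h, map_zero])

/-- Monomials with exponents in `ℕ` in Laurent monomials `y_j = x^{a_j} t^{b_j}` are Laurent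
monomials in `x, t`. -/
theorem adValue_exists_mono (x : Fin n → K) (hx0 : ∀ i, x i ≠ 0) (t : K) (ht0 : t ≠ 0)
    (y : Fin n → K) (af : Fin n → Fin n → ℤ) (bf : Fin n → ℤ)
    (hyab : ∀ j, y j = (∏ i, x i ^ (af j i)) * t ^ (bf j)) (μ : Fin n → ℕ) :
    ∃ (a : Fin n → ℤ) (b : ℤ), (∏ j, y j ^ (μ j)) = (∏ i, x i ^ (a i)) * t ^ b := by
  classical
  let IsMono : K → Prop := fun z => ∃ (a : Fin n → ℤ) (b : ℤ), z = (∏ i, x i ^ (a i)) * t ^ b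
  have mono_mul : ∀ z w, IsMono z → IsMono w → IsMono (z * w) := by
    rintro z w ⟨a, b, rfl⟩ ⟨a', b', rfl⟩
    refine ⟨a + a', b + b', ?_⟩
    rw [prod_zpow_add_eq x hx0, zpow_add₀ ht0]
    ring
  have mono_one : IsMono 1 := ⟨0, 0, by simp⟩
  have mono_pow : ∀ (z : K) (m : ℕ), IsMono z → IsMono (z ^ m) := fun z m hz => by
    induction m with
    | zero => simpa using mono_one
    | succ m ih =>
      rw [pow_succ]
      exact mono_mul _ _ ih hz
  obtain ⟨a, b, h⟩ : IsMono (∏ j, y j ^ (μ j)) :=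
    Finset.prod_induction _ IsMono (fun a b ha hb => mono_mul a b ha hb) mono_one
      fun j _ => mono_pow _ _ ⟨af j, bf j, hyab j⟩
  exact ⟨a, b, h⟩

end Theta

/-- Registered anchor of this helper file: `t ≠ 0` in the value step. -/
theorem adValue_anchor_construct : ∀ (K : Type) [Field K] (O : ValuationSubring K) (p n : ℕ), p ≠ 0 → ∀ (x : Fin n → K), (∀ i, x i ≠ 0) → ∀ (t u : K) (α : Fin n → ℕ), O.valuation u = 1 → t ^ p = (∏ i, x i ^ (α i)) * u → t ≠ 0 := by
  intro K _ O p n hp0 x hx0 t u α hvu htp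
  exact adValue_t_ne_zero O hp0 x hx0 t u α hvu htp

end Summit.ResolutionOfSingularities.ResolutionOfSingularities.Theorems.PfaffLine

end
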